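import Summits.QuantumFields.YangMills.Theorems.LocalInsertionMomentOfWindowTail
import Summits.QuantumFields.YangMills.Theorems.LocalInsertionMedianOfInsertion
import HarnessLib

/-!
# Line «local_insertion» on crux `HistoryTailL` (stmt-QuantumFields-19936) — `LocalInsertionL` ⟺ THE K-UNIFORM LINEAR-EXPONENTIAL WINDOW TAIL
# BELOW BAŁABAN'S THRESHOLD (an `Iff` by kernel for the deciding crux stmt-QuantumFields-23607 of route LocalInsertion)

Cell `ym3-torus` (YM ladder rung R3 = continuum SU(2) Yang–Mills on the three-torus — a RUNG, NOT the Clay problem: not d = 4, not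
infinite volume, not a mass gap), width seat `ym-ust-19936-w3` gen 11, `--supports stmt-QuantumFields-19936 --as helper`.  THEOREMS ONLY,
definition-free; by-name layer (route cone: imports file A ✓`LocalInsertionMomentOfWindowTail`, which names `Theses.LocalInsertion.LocalInsertionL`,
and the route-independent ✓`LocalInsertionMedianOfInsertion`).  HONEST FRAMING: a RE-EXPRESSION of the open crux `LocalInsertionL` (23607) in the
tail currency; NEITHER side is proved; nothing of 23607, the glue 23608, the stubs of `Cruxes/HistoryTailL/Lines/local_insertion.lean`, the crux
`HistoryTailL` or any summit statement is proved.

WHY A SEPARATE SHARPENING.  File A's `localInsertionL_of_windowExpTail` asks the tail `Gibbs_K(G(a,j) ∩ {n·g ≤ dist1(Ū^j(∂a))}) ≤ C·e^{−κn}` at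
EVERY level `n : ℕ`; but the staircase majorant under the cap `p(g)` has no steps above `⌊p(g)⌋`, and conversely the insertion bound controls the
tail only up to the cap (between `θ(K−j)` and `2` the capped moment is blind).  Asking the tail exactly at the levels `n·g_{K−j} ≤ θ(K−j)` makes the
two currencies EQUIVALENT:
* §1 `setIntegral_exp_mul_min_le_of_expTailBelowCap` (abstract: tail only for `n ≤ max p 0`), `insertionIntegral_le_of_expTailBelowCap` (one
  instance, arbitrary measurable `G`, levels `n·g ≤ θ(K−j)`; `γ ≤ 1`, `b₀ ≥ 0` so that `p(g) ≥ 0`).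
* §2 ★★`localInsertionL_of_windowExpTailBelowCap` (`ε := κ/2`, `M₀ := C·e^{κ/2}/(1 − e^{−κ/2})`), ★★`windowExpTailBelowCap_of_localInsertionL`
  (`κ := ε`, `C := M₀`, via ✓`MedianOfInsertion.windowExpTailBelowCap_of_insertion`), ★★★`localInsertionL_iff_windowExpTailBelowCap`.
* §3 (v1.1 append, same seat) the REGISTERED STUB TEXTS of `Lines/local_insertion.lean` 48f0ac19 as `Iff`s with the height-restricted tails:
  ★★`insertionHeightOne_iff_windowExpTailBelowCap` (`j ≤ 1`), ★★`insertionHigher_iff_windowExpTailBelowCap` (`2 ≤ j`).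
* §4 (v1.2 append, same seat) ★★`medianFamily_of_localInsertionL`: `LocalInsertionL` ∧ ⟨K-uniform local goodness `Gibbs_K(G(a,j)ᶜ) ≤ ¼`⟩ ⇒ the
  MEDIAN FAMILY at scale `g` (`m` after `(b₀,p₀)`), via ✓`median_of_insertion` and `level_le_θBal_of_coupling_small` (`m ≤ b₀·log g⁻¹ ≤ p(g)` once
  `γ ≤ exp(−2m/b₀)`) — the converse of ✓`insertionFits_of_concentration_median`'s use of the median family.
[cite: Balaban1985UV3, (7) p.257 and (71) p.273]
-/

set_option autoImplicit false

noncomputable section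

open scoped BigOperators
open MeasureTheory Set
open Literature.MathematicalPhysics.QuantumFieldTheory.Balaban1983to89
open Literature.MathematicalPhysics.QuantumFieldTheory.Balaban1983to89.T3ContinuumYM3Torus
open Literature.MathematicalPhysics.QuantumFieldTheory.Balaban1983to89.T3UnitScaleTilt
open Literature.MathematicalPhysics.QuantumFieldTheory.Balaban1983to89.T3UnitLawDensityEML
open Summit.QuantumFields.YangMills.Theorems.LocalInsertion.HistoryTailOfInsertion (measurable_flux)
open Summit.QuantumFields.YangMills.Theorems.LocalInsertion.MomentOfWindowTail
  (setIntegral_exp_mul_min_le_sum coupling_pos momentConst_nonneg measurableSet_window)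

namespace Summit.QuantumFields.YangMills.Theorems.LocalInsertion.IffWindowTailBelowCap

/-! ## §1 Below the cap: abstract and one-instance forms -/

/-- **Linear-exponential tail BELOW THE CAP ⇒ capped exponential moment.** As `setIntegral_exp_mul_min_le_of_expTail`, but the tail
`μ(G ∩ {n ≤ Y}) ≤ C·e^{−κn}` is asked only for the levels `n ≤ max p 0` (the staircase majorant has no higher steps). [folklore] -/
theorem setIntegral_exp_mul_min_le_of_expTailBelowCap {Ω : Type*} [MeasurableSpace Ω] (μ : Measure Ω) [IsFiniteMeasure μ]
    {G : Set Ω} (hG : MeasurableSet G) {Y : Ω → ℝ} (hY : Measurable Y) (hY0 : ∀ ω ∈ G, 0 ≤ Y ω)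
    {ε κ C p : ℝ} (hε : 0 ≤ ε) (hεκ : ε < κ) (hC : 0 ≤ C)
    (htail : ∀ n : ℕ, (n : ℝ) ≤ max p 0 → μ.real (G ∩ {ω | (n : ℝ) ≤ Y ω}) ≤ C * Real.exp (-(κ * n))) :
    ∫ ω in G, Real.exp (ε * min (Y ω) p) ∂μ ≤ C * Real.exp ε / (1 - Real.exp (ε - κ)) := by
  have hr0 : 0 ≤ Real.exp (ε - κ) := (Real.exp_pos _).le
  have hr1 : Real.exp (ε - κ) < 1 := Real.exp_lt_one_iff.mpr (by linarith)
  refine (setIntegral_exp_mul_min_le_sum μ hG hY hY0 hε p).trans ?_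
  have hterm : ∀ n ∈ Finset.range (⌊max p 0⌋₊ + 1), Real.exp (ε * (n + 1)) * μ.real (G ∩ {ω | (n : ℝ) ≤ Y ω}) ≤
      C * Real.exp ε * Real.exp (ε - κ) ^ n := by
    intro n hn
    have hn' : (n : ℝ) ≤ max p 0 := by
      rw [Finset.mem_range, Nat.lt_add_one_iff] at hn
      exact (Nat.le_floor_iff (le_max_right p 0)).mp hn
    calc Real.exp (ε * (n + 1)) * μ.real (G ∩ {ω | (n : ℝ) ≤ Y ω})
        ≤ Real.exp (ε * (n + 1)) * (C * Real.exp (-(κ * n))) :=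
          mul_le_mul_of_nonneg_left (htail n hn') (Real.exp_pos _).le
      _ = C * Real.exp ε * Real.exp (ε - κ) ^ n := by
          have h1 : Real.exp (ε * (n + 1)) = Real.exp (ε * n) * Real.exp ε := by
            rw [← Real.exp_add]; ring_nf
          have h2 : Real.exp (ε - κ) ^ n = Real.exp (ε * n) * Real.exp (-(κ * n)) := by
            rw [← Real.exp_nat_mul, ← Real.exp_add]; ring_nf
          rw [h1, h2]; ring
  calc ∑ n ∈ Finset.range (⌊max p 0⌋₊ + 1), Real.exp (ε * (n + 1)) * μ.real (G ∩ {ω | (n : ℝ) ≤ Y ω})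
      ≤ ∑ n ∈ Finset.range (⌊max p 0⌋₊ + 1), C * Real.exp ε * Real.exp (ε - κ) ^ n := Finset.sum_le_sum hterm
    _ = C * Real.exp ε * ∑ n ∈ Finset.range (⌊max p 0⌋₊ + 1), Real.exp (ε - κ) ^ n := by rw [Finset.mul_sum]
    _ ≤ C * Real.exp ε * (1 - Real.exp (ε - κ))⁻¹ := by
        refine mul_le_mul_of_nonneg_left ?_ (mul_nonneg hC (Real.exp_pos _).le)
        rw [← tsum_geometric_of_lt_one hr0 hr1]
        exact Summable.sum_le_tsum _ (fun n _ => pow_nonneg hr0 n) (summable_geometric_of_lt_one hr0 hr1)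
    _ = C * Real.exp ε / (1 - Real.exp (ε - κ)) := by rw [div_eq_mul_inv]

/-- **TAIL BELOW THE THRESHOLD ⇒ THE INSERTION INTEGRAL**, one instance, arbitrary measurable event `G`: if
`Gibbs_K(G ∩ {n·g ≤ dist1(Ū^j(∂a))}) ≤ C·e^{−κn}` for every `n : ℕ` with `n·g ≤ θ(K−j)` (`g = g_{K−j}`, i.e. `n ≤ p(g)`), `0 ≤ ε < κ`, `γ ≤ 1`, `b₀ ≥ 0`,
then `∫_G exp(ε·min(dist1(Ū^j(∂a))/g, p(g))) dGibbs_K ≤ C·e^{ε}/(1 − e^{ε−κ})`. [cite: Balaban1985UV3, (7) p.257 and (71) p.273] -/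
theorem insertionIntegral_le_of_expTailBelowCap (F : T3Family) {γ ε κ C b₀ : ℝ} (hγ : 0 < γ) (hγ1 : γ ≤ 1) (hε : 0 ≤ ε) (hεκ : ε < κ)
    (hC : 0 ≤ C) (hb₀ : 0 ≤ b₀) (p₀ : ℝ) {K j : ℕ} (a : Plaq (F.P K) j)
    {G : Set (GaugeField (F.P K) 0 (Matrix.specialUnitaryGroup (Fin 2) ℂ))} (hG : MeasurableSet G)
    (htail : ∀ n : ℕ, (n : ℝ) * Real.sqrt (γ * ((F.L : ℝ)⁻¹) ^ (K - j)) ≤ θBal F.L γ b₀ p₀ (K - j) →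
      (gibbsK F ℰp γ K).real (G ∩ {U | (n : ℝ) * Real.sqrt (γ * ((F.L : ℝ)⁻¹) ^ (K - j)) ≤ GaugeGroup.dist1 (GaugeField.plaqHol (Averaging.iter (fun i' => BlockAveraging.blockAvg (P := F.P K) (j := i') ℰp) j U) a)}) ≤ C * Real.exp (-(κ * n))) :
    ∫ U in G, Real.exp (ε * min (GaugeGroup.dist1 (GaugeField.plaqHol (Averaging.iter (fun i' => BlockAveraging.blockAvg (P := F.P K) (j := i') ℰp) j U) a) / Real.sqrt (γ * ((F.L : ℝ)⁻¹) ^ (K - j))) (B10.pFun b₀ p₀ (Real.sqrt (γ * ((F.L : ℝ)⁻¹) ^ (K - j))))) ∂(gibbsK F ℰp γ K) ≤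
      C * Real.exp ε / (1 - Real.exp (ε - κ)) := by
  haveI := isProbabilityMeasure_gibbsK F ℰp hγ.le K
  have hg := coupling_pos F hγ (K - j)
  have hg1 : Real.sqrt (γ * ((F.L : ℝ)⁻¹) ^ (K - j)) ≤ 1 := Literature.MathematicalPhysics.QuantumFieldTheory.Balaban1983to89.T3Thresholds.coupling_le_one F.hL.2.le hγ hγ1 (K - j)
  have hP0 : 0 ≤ B10.pFun b₀ p₀ (Real.sqrt (γ * ((F.L : ℝ)⁻¹) ^ (K - j))) := B10.pFun_nonneg b₀ p₀ _ hb₀ hg hg1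
  have hθ : θBal F.L γ b₀ p₀ (K - j) = Real.sqrt (γ * ((F.L : ℝ)⁻¹) ^ (K - j)) * B10.pFun b₀ p₀ (Real.sqrt (γ * ((F.L : ℝ)⁻¹) ^ (K - j))) := rfl
  have hset : ∀ n : ℕ, G ∩ {U : GaugeField (F.P K) 0 (Matrix.specialUnitaryGroup (Fin 2) ℂ) | (n : ℝ) ≤ GaugeGroup.dist1 (GaugeField.plaqHol (Averaging.iter (fun i' => BlockAveraging.blockAvg (P := F.P K) (j := i') ℰp) j U) a) / Real.sqrt (γ * ((F.L : ℝ)⁻¹) ^ (K - j))} =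
      G ∩ {U | (n : ℝ) * Real.sqrt (γ * ((F.L : ℝ)⁻¹) ^ (K - j)) ≤ GaugeGroup.dist1 (GaugeField.plaqHol (Averaging.iter (fun i' => BlockAveraging.blockAvg (P := F.P K) (j := i') ℰp) j U) a)} := by
    intro n; ext U; simp only [Set.mem_inter_iff, Set.mem_setOf_eq, le_div_iff₀ hg]
  refine setIntegral_exp_mul_min_le_of_expTailBelowCap (gibbsK F ℰp γ K) hG ((measurable_flux F K j a).div_const _)
    (fun U _ => div_nonneg (GaugeGroup.dist1_nonneg _) (Real.sqrt_nonneg _)) hε hεκ hC (fun n hn => ?_)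
  rw [max_eq_left hP0] at hn
  rw [hset n]
  exact htail n (by rw [hθ, mul_comm]; exact mul_le_mul_of_nonneg_left hn hg.le)

/-! ## §2 By name: both directions and the `Iff` -/

/-- **THE WINDOW TAIL BELOW THE CAP GIVES `LocalInsertionL`** (stmt-QuantumFields-23607, BY NAME) — as `localInsertionL_of_windowExpTail`, with the
tail asked only at the levels `n·g_{K−j} ≤ θ(K−j)`.  CONDITIONAL: the hypothesis is not in the tree. [cite: Balaban1985UV3, (7) p.257 and (71) p.273] -/
theorem localInsertionL_of_windowExpTailBelowCap
    (hT : ∀ (L : ℕ), ∃ κ : ℝ, 0 < κ ∧ ∀ (b₀ p₀ : ℝ), 0 < b₀ → 2 < p₀ → ∃ C : ℝ, 0 ≤ C ∧ ∃ γ₁ : ℝ, 0 < γ₁ ∧ γ₁ ≤ 1 ∧ ∀ (F : T3Family) (γ : ℝ), F.L = L → 0 < γ → γ ≤ γ₁ → ∀ (K j : ℕ), 1 ≤ j → j ≤ K → ∀ (a : Plaq (F.P K) j) (n : ℕ), (n : ℝ) * Real.sqrt (γ * ((F.L : ℝ)⁻¹) ^ (K - j)) ≤ θBal F.L γ b₀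 p₀ (K - j) → (gibbsK F ℰp γ K).real ({U : GaugeField (F.P K) 0 (Matrix.specialUnitaryGroup (Fin 2) ℂ) | (∀ (i : ℕ) (q : Plaq (F.P K) i), i < j → Site.tdist (fun k => ((((q.src k).val * F.L ^ i : ℕ)) : ZMod ((F.P K).sitesPerDir 0))) (fun k => ((((a.src k).val * F.L ^ j : ℕ)) : ZMod ((F.P K).sitesPerDir 0))) + 64 * F.L ^ i ≤ 64 * F.L ^ j → GaugeGroup.dist1 (GaugeField.plaqHol (Averaging.iter (fun i' => BlockAveraging.blockAvg (P := F.P K) (j := i') ℰp) i U) q) < θBal F.L γ b₀ p₀ (K - i))} ∩ {U | (n : ℝ) * Real.sqrt (γ * ((F.L : ℝ)⁻¹) ^ (K - j)) ≤ GaugeGroup.dist1 (GaugeField.plaqHol (Averaging.iter (fun i' => BlockAveraging.blockAvg (P := F.P K) (j := i') ℰp) j U) a)}) ≤ C * Real.exp (-(κ * n))) :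
    Summit.QuantumFields.YangMills.Theses.LocalInsertion.LocalInsertionL := by
  intro L
  obtain ⟨κ, hκ, hL⟩ := hT L
  refine ⟨κ / 2, by linarith, fun b₀ p₀ hb₀ hp₀ => ?_⟩
  obtain ⟨C, hC, γ₁, hγ₁, hγ₁1, hF⟩ := hL b₀ p₀ hb₀ hp₀
  have hεκ : κ / 2 < κ := by linarith
  refine ⟨C * Real.exp (κ / 2) / (1 - Real.exp (κ / 2 - κ)), momentConst_nonneg hεκ hC, γ₁, hγ₁, hγ₁1,
    fun F γ hFL hγ hγle K j hj hjK a => ?_⟩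
  exact insertionIntegral_le_of_expTailBelowCap F hγ (hγle.trans hγ₁1) (by linarith) hεκ hC hb₀.le p₀ a
    (measurableSet_window F γ b₀ p₀ K j a) (hF F γ hFL hγ hγle K j hj hjK a)

/-- **`LocalInsertionL` GIVES THE WINDOW TAIL BELOW THE CAP** (the converse, BY NAME): Chernoff at every level `n·g ≤ θ(K−j)`
(✓`MedianOfInsertion.windowExpTailBelowCap_of_insertion`), `κ := ε`, `C := M₀`. [cite: Balaban1985UV3, (7) p.257 and (71) p.273] -/
theorem windowExpTailBelowCap_of_localInsertionL
    (hI : Summit.QuantumFields.YangMills.Theses.LocalInsertion.LocalInsertionL) :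
    ∀ (L : ℕ), ∃ κ : ℝ, 0 < κ ∧ ∀ (b₀ p₀ : ℝ), 0 < b₀ → 2 < p₀ → ∃ C : ℝ, 0 ≤ C ∧ ∃ γ₁ : ℝ, 0 < γ₁ ∧ γ₁ ≤ 1 ∧ ∀ (F : T3Family) (γ : ℝ), F.L = L → 0 < γ → γ ≤ γ₁ → ∀ (K j : ℕ), 1 ≤ j → j ≤ K → ∀ (a : Plaq (F.P K) j) (n : ℕ), (n : ℝ) * Real.sqrt (γ * ((F.L : ℝ)⁻¹) ^ (K - j)) ≤ θBal F.L γ b₀ p₀ (K - j) → (gibbsK F ℰp γ K).real ({U : GaugeField (F.P K) 0 (Matrix.specialUnitaryGroup (Fin 2) ℂ) | (∀ (i : ℕ) (q : Plaq (F.P K) i), i < j → Site.tdist (fun k => ((((q.src k).val * F.L ^ i : ℕ)) : ZMod ((F.P K).sitesPerDir 0))) (fun k => ((((a.src k).val * F.L ^ j : ℕ)) : ZMod ((F.P K).sitesPerDir 0))) + 64 * F.L ^ i ≤ 64 * F.L ^ j → GaugeGroup.dist1 (GaugeField.plaqHol (Averaging.iter (fun i' => BlockAveraging.blockAvg (P :=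 F.P K) (j := i') ℰp) i U) q) < θBal F.L γ b₀ p₀ (K - i))} ∩ {U | (n : ℝ) * Real.sqrt (γ * ((F.L : ℝ)⁻¹) ^ (K - j)) ≤ GaugeGroup.dist1 (GaugeField.plaqHol (Averaging.iter (fun i' => BlockAveraging.blockAvg (P := F.P K) (j := i') ℰp) j U) a)}) ≤ C * Real.exp (-(κ * n)) := by
  intro L
  obtain ⟨ε, hε, hL⟩ := hI L
  refine ⟨ε, hε, fun b₀ p₀ hb₀ hp₀ => ?_⟩
  obtain ⟨M₀, hM₀, γ₁, hγ₁, hγ₁1, hF⟩ := hL b₀ p₀ hb₀ hp₀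
  refine ⟨M₀, hM₀, γ₁, hγ₁, hγ₁1, fun F γ hFL hγ hγle K j hj hjK a n hn => ?_⟩
  exact Summit.QuantumFields.YangMills.Theorems.LocalInsertion.MedianOfInsertion.windowExpTailBelowCap_of_insertion F hγ hε a
    (measurableSet_window F γ b₀ p₀ K j a) (hF F γ hFL hγ hγle K j hj hjK a) n hn

/-- **`LocalInsertionL` ⟺ THE K-UNIFORM LINEAR-EXPONENTIAL WINDOW TAIL BELOW BAŁABAN'S THRESHOLD** (stmt-QuantumFields-23607 by name, an `Iff`
by kernel; `ε ↔ κ` up to a factor 2, constants explicit in the two directions).  The deciding crux of route LocalInsertion, re-expressed in the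
currency every concentration engine produces: for each `L` one rate `κ > 0`, and for all thresholds a `K`-, `j`-, plaquette-uniform `C` with
`Gibbs_K(G(a,j) ∩ {n·g_{K−j} ≤ dist1(Ū^j(∂a))}) ≤ C·e^{−κn}` at every level `n·g_{K−j} ≤ θ(K−j)`.  Neither side is proved here.
[cite: Balaban1985UV3, (7) p.257 and (71) p.273] -/
theorem localInsertionL_iff_windowExpTailBelowCap :
    Summit.QuantumFields.YangMills.Theses.LocalInsertion.LocalInsertionL ↔
    (∀ (L : ℕ), ∃ κ : ℝ, 0 < κ ∧ ∀ (b₀ p₀ : ℝ), 0 < b₀ → 2 < p₀ → ∃ C : ℝ, 0 ≤ C ∧ ∃ γ₁ : ℝ, 0 < γ₁ ∧ γ₁ ≤ 1 ∧ ∀ (F : T3Family) (γ : ℝ), F.L = L → 0 < γ → γ ≤ γ₁ → ∀ (K j : ℕ), 1 ≤ j → j ≤ K → ∀ (a : Plaq (F.P K) j) (n : ℕ), (n : ℝ) * Real.sqrt (γ * ((F.L : ℝ)⁻¹) ^ (K - j)) ≤ θBal F.L γ b₀ p₀ (K - j) → (gibbsK F ℰp γ K).real ({U : GaugeField (F.P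 K) 0 (Matrix.specialUnitaryGroup (Fin 2) ℂ) | (∀ (i : ℕ) (q : Plaq (F.P K) i), i < j → Site.tdist (fun k => ((((q.src k).val * F.L ^ i : ℕ)) : ZMod ((F.P K).sitesPerDir 0))) (fun k => ((((a.src k).val * F.L ^ j : ℕ)) : ZMod ((F.P K).sitesPerDir 0))) + 64 * F.L ^ i ≤ 64 * F.L ^ j → GaugeGroup.dist1 (GaugeField.plaqHol (Averaging.iter (fun i' => BlockAveraging.blockAvg (P := F.P K) (j := i') ℰp) i U) q) < θBal F.L γ b₀ p₀ (K - i))} ∩ {U | (n : ℝ) * Real.sqrt (γ * ((F.L : ℝ)⁻¹) ^ (K - j)) ≤ GaugeGroup.dist1 (GaugeField.plaqHol (Averaging.iter (fun i' => BlockAveraging.blockAvg (P := F.P K) (j := i') ℰp) j U) a)}) ≤ C * Real.exp (-(κ * n))) :=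
  ⟨windowExpTailBelowCap_of_localInsertionL, localInsertionL_of_windowExpTailBelowCap⟩


/-! ## §3 (v1.1, same seat) The registered stub texts, below the cap, as `Iff`s -/

/-- **THE REGISTERED STUB `stub_insertionHeightOne` ⟺ THE WINDOW TAIL BELOW THE CAP AT HEIGHTS `j ≤ 1`** (line `local_insertion` 48f0ac19; the stub TEXT on the
left, verbatim; an `Iff` by kernel: `→` by Chernoff at every level with `κ := ε₀`, `C := M₀(ε₀)`; `←` with `ε₀ := κ/2` and, for `0 < ε ≤ ε₀`,
`M₀(ε) := C·e^{ε}/(1 − e^{ε−κ})`).  Neither side is proved here. [cite: Balaban1985UV3, (7) p.257 and (71) p.273] -/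
theorem insertionHeightOne_iff_windowExpTailBelowCap :
    (open Literature.MathematicalPhysics.QuantumFieldTheory.Balaban1983to89 Literature.MathematicalPhysics.QuantumFieldTheory.Balaban1983to89.T3ContinuumYM3Torus in ∀ (L : ℕ), ∃ ε₀ : ℝ, 0 < ε₀ ∧ ∀ (ε : ℝ), 0 < ε → ε ≤ ε₀ → ∀ (b₀ p₀ : ℝ), 0 < b₀ → 2 < p₀ → ∃ M₀ : ℝ, 0 ≤ M₀ ∧ ∃ γ₁ : ℝ, 0 < γ₁ ∧ γ₁ ≤ 1 ∧ ∀ (F : T3Family) (γ : ℝ), F.L = L → 0 < γ → γ ≤ γ₁ → ∀ (K j : ℕ), 1 ≤ j → j ≤ K → j ≤ 1 → ∀ (a : Plaq (F.P K) j), ∫ U in {U | (∀ (i : ℕ) (q : Plaq (F.P K) i), i < j → Site.tdist (fun k => ((((q.src k).val * F.L ^ i : ℕ)) : ZMod ((F.P K).sitesPerDir 0))) (fun k => ((((a.src k).val * F.L ^ j : ℕ)) : ZMod ((F.P K).sitesPerDir 0))) + 64 * F.L ^ i ≤ 64 * F.L ^ j → GaugeGroup.dist1 (GaugeField.plaqHol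 (Averaging.iter (fun i' => BlockAveraging.blockAvg (P := F.P K) (j := i') T3UnitLawDensityEML.ℰp) i U) q) < T3UnitScaleTilt.θBal F.L γ b₀ p₀ (K - i))}, Real.exp (ε * min (GaugeGroup.dist1 (GaugeField.plaqHol (Averaging.iter (fun i' => BlockAveraging.blockAvg (P := F.P K) (j := i') T3UnitLawDensityEML.ℰp) j U) a) / Real.sqrt (γ * ((F.L : ℝ)⁻¹) ^ (K - j))) (B10.pFun b₀ p₀ (Real.sqrt (γ * ((F.L : ℝ)⁻¹) ^ (K - j))))) ∂(T3UnitScaleTilt.gibbsK F T3UnitLawDensityEML.ℰp γ K) ≤ M₀) ↔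
    (∀ (L : ℕ), ∃ κ : ℝ, 0 < κ ∧ ∀ (b₀ p₀ : ℝ), 0 < b₀ → 2 < p₀ → ∃ C : ℝ, 0 ≤ C ∧ ∃ γ₁ : ℝ, 0 < γ₁ ∧ γ₁ ≤ 1 ∧ ∀ (F : T3Family) (γ : ℝ), F.L = L → 0 < γ → γ ≤ γ₁ → ∀ (K j : ℕ), 1 ≤ j → j ≤ K → j ≤ 1 → ∀ (a : Plaq (F.P K) j) (n : ℕ), (n : ℝ) * Real.sqrt (γ * ((F.L : ℝ)⁻¹) ^ (K - j)) ≤ θBal F.L γ b₀ p₀ (K - j) → (gibbsK F ℰp γ K).real ({U : GaugeField (F.P K) 0 (Matrix.specialUnitaryGroup (Fin 2) ℂ) | (∀ (i : ℕ) (q : Plaq (F.P K) i), i < j → Site.tdist (fun k => ((((q.src k).val * F.L ^ i : ℕ)) : ZMod ((F.P K).sitesPerDir 0))) (fun k => ((((a.src k).val * F.L ^ j : ℕ)) : ZMod ((F.P K).sitesPerDir 0))) + 64 * F.L ^ i ≤ 64 * F.L ^ j → GaugeGroup.dist1 (GaugeField.plaqHol (Averaging.iter (fun i' => BlockAveraging.blockAvg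 (P := F.P K) (j := i') ℰp) i U) q) < θBal F.L γ b₀ p₀ (K - i))} ∩ {U | (n : ℝ) * Real.sqrt (γ * ((F.L : ℝ)⁻¹) ^ (K - j)) ≤ GaugeGroup.dist1 (GaugeField.plaqHol (Averaging.iter (fun i' => BlockAveraging.blockAvg (P := F.P K) (j := i') ℰp) j U) a)}) ≤ C * Real.exp (-(κ * n))) := by
  constructor
  · intro hS L
    obtain ⟨ε₀, hε₀, hL⟩ := hS L
    refine ⟨ε₀, hε₀, fun b₀ p₀ hb₀ hp₀ => ?_⟩
    obtain ⟨M₀, hM₀, γ₁, hγ₁, hγ₁1, hF⟩ := hL ε₀ hε₀ le_rfl b₀ p₀ hb₀ hp₀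
    refine ⟨M₀, hM₀, γ₁, hγ₁, hγ₁1, fun F γ hFL hγ hγle K j hj hjK hj1 a n hn => ?_⟩
    exact Summit.QuantumFields.YangMills.Theorems.LocalInsertion.MedianOfInsertion.windowExpTailBelowCap_of_insertion F hγ hε₀ a
      (measurableSet_window F γ b₀ p₀ K j a) (hF F γ hFL hγ hγle K j hj hjK hj1 a) n hn
  · intro hT L
    obtain ⟨κ, hκ, hL⟩ := hT L
    refine ⟨κ / 2, by linarith, fun ε hε hεle b₀ p₀ hb₀ hp₀ => ?_⟩
    obtain ⟨C, hC, γ₁, hγ₁, hγ₁1, hF⟩ := hL b₀ p₀ hb₀ hp₀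
    have hεκ : ε < κ := by linarith
    refine ⟨C * Real.exp ε / (1 - Real.exp (ε - κ)), momentConst_nonneg hεκ hC, γ₁, hγ₁, hγ₁1,
      fun F γ hFL hγ hγle K j hj hjK hj1 a => ?_⟩
    exact insertionIntegral_le_of_expTailBelowCap F hγ (hγle.trans hγ₁1) hε.le hεκ hC hb₀.le p₀ a
      (measurableSet_window F γ b₀ p₀ K j a) (hF F γ hFL hγ hγle K j hj hjK hj1 a)

/-- **THE REGISTERED STUB `stub_insertionHigher` ⟺ THE WINDOW TAIL BELOW THE CAP AT HEIGHTS `2 ≤ j`** (line `local_insertion` 48f0ac19; the stub TEXT on the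
left, verbatim; an `Iff` by kernel: `→` by Chernoff at every level with `κ := ε₀`, `C := M₀(ε₀)`; `←` with `ε₀ := κ/2` and, for `0 < ε ≤ ε₀`,
`M₀(ε) := C·e^{ε}/(1 − e^{ε−κ})`).  Neither side is proved here. [cite: Balaban1985UV3, (7) p.257 and (71) p.273] -/
theorem insertionHigher_iff_windowExpTailBelowCap :
    (open Literature.MathematicalPhysics.QuantumFieldTheory.Balaban1983to89 Literature.MathematicalPhysics.QuantumFieldTheory.Balaban1983to89.T3ContinuumYM3Torus in ∀ (L : ℕ), ∃ ε₀ : ℝ, 0 < ε₀ ∧ ∀ (ε : ℝ), 0 < ε → ε ≤ ε₀ → ∀ (b₀ p₀ : ℝ), 0 < b₀ → 2 < p₀ → ∃ M₀ : ℝ, 0 ≤ M₀ ∧ ∃ γ₁ : ℝ, 0 < γ₁ ∧ γ₁ ≤ 1 ∧ ∀ (F : T3Family) (γ : ℝ), F.L = L → 0 < γ → γ ≤ γ₁ → ∀ (K j : ℕ), 1 ≤ j → j ≤ K → 2 ≤ j → ∀ (a : Plaq (F.P K) j), ∫ U in {U | (∀ (i : ℕ) (q : Plaq (F.P K) i), i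 < j → Site.tdist (fun k => ((((q.src k).val * F.L ^ i : ℕ)) : ZMod ((F.P K).sitesPerDir 0))) (fun k => ((((a.src k).val * F.L ^ j : ℕ)) : ZMod ((F.P K).sitesPerDir 0))) + 64 * F.L ^ i ≤ 64 * F.L ^ j → GaugeGroup.dist1 (GaugeField.plaqHol (Averaging.iter (fun i' => BlockAveraging.blockAvg (P := F.P K) (j := i') T3UnitLawDensityEML.ℰp) i U) q) < T3UnitScaleTilt.θBal F.L γ b₀ p₀ (K - i))}, Real.exp (ε * min (GaugeGroup.dist1 (GaugeField.plaqHol (Averaging.iter (fun i' => BlockAveraging.blockAvg (P := F.P K) (j := i') T3UnitLawDensityEML.ℰp) j U) a) / Real.sqrt (γ * ((F.L : ℝ)⁻¹) ^ (K - j))) (B10.pFun b₀ p₀ (Real.sqrt (γ * ((F.L : ℝ)⁻¹) ^ (K - j))))) ∂(T3UnitScaleTilt.gibbsK F T3UnitLawDensityEML.ℰp γ K) ≤ M₀) ↔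
    (∀ (L : ℕ), ∃ κ : ℝ, 0 < κ ∧ ∀ (b₀ p₀ : ℝ), 0 < b₀ → 2 < p₀ → ∃ C : ℝ, 0 ≤ C ∧ ∃ γ₁ : ℝ, 0 < γ₁ ∧ γ₁ ≤ 1 ∧ ∀ (F : T3Family) (γ : ℝ), F.L = L → 0 < γ → γ ≤ γ₁ → ∀ (K j : ℕ), 1 ≤ j → j ≤ K → 2 ≤ j → ∀ (a : Plaq (F.P K) j) (n : ℕ), (n : ℝ) * Real.sqrt (γ * ((F.L : ℝ)⁻¹) ^ (K - j)) ≤ θBal F.L γ b₀ p₀ (K - j) → (gibbsK F ℰp γ K).real ({U : GaugeField (F.P K) 0 (Matrix.specialUnitaryGroup (Fin 2) ℂ) | (∀ (i : ℕ) (q : Plaq (F.P K) i), i < j → Site.tdist (fun k => ((((q.src k).val * F.L ^ i : ℕ)) : ZMod ((F.P K).sitesPerDir 0))) (fun k => ((((a.src k).val * F.L ^ j : ℕ)) : ZMod ((F.P K).sitesPerDir 0))) + 64 * F.L ^ i ≤ 64 * F.L ^ j → GaugeGroup.dist1 (GaugeField.plaqHol (Averaging.iter (fun i' => BlockAveraging.blockAvg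 (P := F.P K) (j := i') ℰp) i U) q) < θBal F.L γ b₀ p₀ (K - i))} ∩ {U | (n : ℝ) * Real.sqrt (γ * ((F.L : ℝ)⁻¹) ^ (K - j)) ≤ GaugeGroup.dist1 (GaugeField.plaqHol (Averaging.iter (fun i' => BlockAveraging.blockAvg (P := F.P K) (j := i') ℰp) j U) a)}) ≤ C * Real.exp (-(κ * n))) := by
  constructor
  · intro hS L
    obtain ⟨ε₀, hε₀, hL⟩ := hS L
    refine ⟨ε₀, hε₀, fun b₀ p₀ hb₀ hp₀ => ?_⟩
    obtain ⟨M₀, hM₀, γ₁, hγ₁, hγ₁1, hF⟩ := hL ε₀ hε₀ le_rfl b₀ p₀ hb₀ hp₀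
    refine ⟨M₀, hM₀, γ₁, hγ₁, hγ₁1, fun F γ hFL hγ hγle K j hj hjK hj2 a n hn => ?_⟩
    exact Summit.QuantumFields.YangMills.Theorems.LocalInsertion.MedianOfInsertion.windowExpTailBelowCap_of_insertion F hγ hε₀ a
      (measurableSet_window F γ b₀ p₀ K j a) (hF F γ hFL hγ hγle K j hj hjK hj2 a) n hn
  · intro hT L
    obtain ⟨κ, hκ, hL⟩ := hT L
    refine ⟨κ / 2, by linarith, fun ε hε hεle b₀ p₀ hb₀ hp₀ => ?_⟩
    obtain ⟨C, hC, γ₁, hγ₁, hγ₁1, hF⟩ := hL b₀ p₀ hb₀ hp₀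
    have hεκ : ε < κ := by linarith
    refine ⟨C * Real.exp ε / (1 - Real.exp (ε - κ)), momentConst_nonneg hεκ hC, γ₁, hγ₁, hγ₁1,
      fun F γ hFL hγ hγle K j hj hjK hj2 a => ?_⟩
    exact insertionIntegral_le_of_expTailBelowCap F hγ (hγle.trans hγ₁1) hε.le hεκ hC hb₀.le p₀ a
      (measurableSet_window F γ b₀ p₀ K j a) (hF F γ hFL hγ hγle K j hj hjK hj2 a)


/-! ## §4 (v1.2, same seat) `LocalInsertionL` gives the MEDIAN FAMILY at scale `g` (modulo local goodness), by name -/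

/-- `m ≤ b₀·log g⁻¹ ≤ p(g)` bookkeeping: for `0 < b₀`, `1 ≤ p₀`, `0 < γ ≤ exp(−2m/b₀)`, `γ ≤ 1`, `1 ≤ L` and any depth `h`, the level `m` is below the
profile: `m·g_h ≤ θ(h) = g_h·p(g_h)` (`g_h = √(γL^{−h}) ≤ √γ`, `(1+x)^{p₀} ≥ 1 + x`; any real `m`). [cite: Balaban1985UV3, (7) p.257] -/
theorem level_le_θBal_of_coupling_small {L : ℕ} (hL : 1 ≤ L) {γ b₀ p₀ m : ℝ} (hγ : 0 < γ) (hγ1 : γ ≤ 1) (hb₀ : 0 < b₀) (hp₀ : 1 ≤ p₀)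
    (hγm : γ ≤ Real.exp (-(2 * m / b₀))) (h : ℕ) :
    m * Real.sqrt (γ * ((L : ℝ)⁻¹) ^ h) ≤ θBal L γ b₀ p₀ h := by
  have hL0 : (0 : ℝ) < L := by exact_mod_cast lt_of_lt_of_le zero_lt_one hL
  have hLinv1 : ((L : ℝ)⁻¹) ^ h ≤ 1 := pow_le_one₀ (inv_nonneg.mpr hL0.le) (inv_le_one_of_one_le₀ (by exact_mod_cast hL))
  set gh := Real.sqrt (γ * ((L : ℝ)⁻¹) ^ h) with hgh
  have hgpos : 0 < gh := Real.sqrt_pos.2 (mul_pos hγ (pow_pos (inv_pos.2 hL0) _))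
  have hg1 : gh ≤ 1 := Literature.MathematicalPhysics.QuantumFieldTheory.Balaban1983to89.T3Thresholds.coupling_le_one hL hγ hγ1 h
  have hgle : gh ≤ Real.sqrt γ := Real.sqrt_le_sqrt (by nlinarith [hγ.le])
  -- `log gh⁻¹ ≥ log (√γ)⁻¹ = (log γ⁻¹)/2 ≥ m / b₀`
  have hsqrtpos : 0 < Real.sqrt γ := Real.sqrt_pos.2 hγ
  have hlog1 : Real.log (Real.sqrt γ)⁻¹ ≤ Real.log gh⁻¹ :=
    Real.log_le_log (inv_pos.mpr hsqrtpos) (inv_anti₀ hgpos hgle)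
  have hlog2 : Real.log (Real.sqrt γ)⁻¹ = -(Real.log γ / 2) := by rw [Real.log_inv, Real.log_sqrt hγ.le]
  have hlogγ : Real.log γ ≤ -(2 * m / b₀) := by
    have := Real.log_le_log hγ hγm
    rwa [Real.log_exp] at this
  have hmb : m / b₀ ≤ Real.log gh⁻¹ := by
    have : m / b₀ ≤ -(Real.log γ / 2) := by
      rw [div_le_iff₀ hb₀]
      have h2 : -(Real.log γ / 2) * b₀ = -(Real.log γ) * b₀ / 2 := by ring
      rw [h2, le_div_iff₀ (by norm_num : (0:ℝ) < 2)]
      have h3 : 2 * m / b₀ * b₀ = 2 * m := by field_simp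
      nlinarith [mul_le_mul_of_nonneg_right hlogγ hb₀.le]
    linarith
  -- `b₀ log gh⁻¹ ≤ p(gh)`
  have hx : 0 ≤ Real.log gh⁻¹ := by
    rw [Real.log_inv]; have := Real.log_nonpos hgpos.le hg1; linarith
  have h1 : 1 + Real.log gh⁻¹ ≤ (1 + Real.log gh⁻¹) ^ p₀ := by
    have := Real.rpow_le_rpow_of_exponent_le (by linarith : (1 : ℝ) ≤ 1 + Real.log gh⁻¹) hp₀
    rwa [Real.rpow_one] at this
  have hP : m ≤ B10.pFun b₀ p₀ gh := by
    unfold B10.pFun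
    have h4 : m ≤ b₀ * Real.log gh⁻¹ := by rw [div_le_iff₀' hb₀] at hmb; exact hmb
    have h5 : b₀ * Real.log gh⁻¹ ≤ b₀ * (1 + Real.log gh⁻¹) ^ p₀ := mul_le_mul_of_nonneg_left (by linarith) hb₀.le
    linarith
  show m * gh ≤ gh * B10.pFun b₀ p₀ gh
  rw [mul_comm]
  exact mul_le_mul_of_nonneg_left hP hgpos.le

/-- **`LocalInsertionL` ⇒ THE MEDIAN FAMILY AT SCALE `g`** (BY NAME, modulo a K-uniform local-goodness family `Gibbs_K(G(a,j)ᶜ) ≤ ¼`): with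
`m := max(log(4M₀)/ε, 0)` (chosen after `(b₀,p₀)`) and `γ₁` shrunk below `exp(−2m/b₀)` so that the level `m` stays below the profile,
✓`MedianOfInsertion.median_of_insertion` gives `½ ≤ Gibbs_K(G(a,j) ∩ {dist1(Ū^j(∂a)) ≤ m·g_{K−j}})` at every height — exactly the `hMed` family
consumed by ✓`InsertionStepOfConcentrationBoxFit.insertionFits_of_concentration_median`.  With it: given 23532 ∧ the window-Lipschitz family ∧
local goodness, the INSERTION FAMILY and the MEDIAN FAMILY are equivalent (interior∕fitting heights).  CONDITIONAL: neither hypothesis is in the tree.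
[cite: Balaban1985UV3, (7) p.257 and (71) p.273] -/
theorem medianFamily_of_localInsertionL
    (hI : Summit.QuantumFields.YangMills.Theses.LocalInsertion.LocalInsertionL)
    (hGood : ∀ (L : ℕ) (b₀ p₀ : ℝ), 0 < b₀ → 2 < p₀ → ∃ γ₁ : ℝ, 0 < γ₁ ∧ γ₁ ≤ 1 ∧ ∀ (F : T3Family) (γ : ℝ), F.L = L → 0 < γ → γ ≤ γ₁ → ∀ (K j : ℕ), 1 ≤ j → j ≤ K → ∀ (a : Plaq (F.P K) j), (gibbsK F ℰp γ K).real {U : GaugeField (F.P K) 0 (Matrix.specialUnitaryGroup (Fin 2) ℂ) | (∀ (i : ℕ) (q : Plaq (F.P K) i), i < j → Site.tdist (fun k => ((((q.src k).val * F.L ^ i : ℕ)) : ZMod ((F.P K).sitesPerDir 0))) (fun k => ((((a.src k).val * F.L ^ j : ℕ)) : ZMod ((F.P K).sitesPerDir 0))) + 64 * F.L ^ i ≤ 64 * F.L ^ j → GaugeGroup.dist1 (GaugeField.plaqHol (Averaging.iter (fun i' => BlockAveraging.blockAvg (P := F.P K) (j := i') ℰp) i U) q) < θBal F.L γ b₀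 p₀ (K - i))}ᶜ ≤ 1 / 4) :
    ∀ (L : ℕ) (b₀ p₀ : ℝ), 0 < b₀ → 2 < p₀ → ∃ m : ℝ, 0 ≤ m ∧ ∃ γ₁ : ℝ, 0 < γ₁ ∧ γ₁ ≤ 1 ∧ ∀ (F : T3Family) (γ : ℝ), F.L = L → 0 < γ → γ ≤ γ₁ → ∀ (K j : ℕ), 1 ≤ j → j ≤ K → ∀ (a : Plaq (F.P K) j), 1 / 2 ≤ (gibbsK F ℰp γ K).real ({U : GaugeField (F.P K) 0 (Matrix.specialUnitaryGroup (Fin 2) ℂ) | (∀ (i : ℕ) (q : Plaq (F.P K) i), i < j → Site.tdist (fun k => ((((q.src k).val * F.L ^ i : ℕ)) : ZMod ((F.P K).sitesPerDir 0))) (fun k => ((((a.src k).val * F.L ^ j : ℕ)) : ZMod ((F.P K).sitesPerDir 0))) + 64 * F.L ^ i ≤ 64 * F.L ^ j → GaugeGroup.dist1 (GaugeField.plaqHol (Averaging.iter (fun i' => BlockAveraging.blockAvg (P := F.P K) (j := i') ℰp) i U) q) < θBal F.L γ b₀ p₀ (K - i))} ∩ {U | GaugeGroup.dist1 (GaugeField.plaqHol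 (Averaging.iter (fun i' => BlockAveraging.blockAvg (P := F.P K) (j := i') ℰp) j U) a) ≤ m * Real.sqrt (γ * ((F.L : ℝ)⁻¹) ^ (K - j))}) := by
  intro L b₀ p₀ hb₀ hp₀
  obtain ⟨ε, hε, hL⟩ := hI L
  obtain ⟨M₀, hM₀, γa, hγa, hγa1, HF⟩ := hL b₀ p₀ hb₀ hp₀
  obtain ⟨γb, hγb, hγb1, HG⟩ := hGood L b₀ p₀ hb₀ hp₀
  set m : ℝ := max (Real.log (4 * M₀) / ε) 0 with hm
  have hm0 : 0 ≤ m := le_max_right _ _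
  refine ⟨m, hm0, min (min γa γb) (Real.exp (-(2 * m / b₀))), lt_min (lt_min hγa hγb) (Real.exp_pos _),
    (min_le_left _ _).trans ((min_le_left _ _).trans hγa1), ?_⟩
  intro F γ hFL hγ hγle K j hj hjK a
  have hγa' : γ ≤ γa := hγle.trans ((min_le_left _ _).trans (min_le_left _ _))
  have hγb' : γ ≤ γb := hγle.trans ((min_le_left _ _).trans (min_le_right _ _))
  have hγe : γ ≤ Real.exp (-(2 * m / b₀)) := hγle.trans (min_le_right _ _)
  have hγ1 : γ ≤ 1 := hγa'.trans hγa1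
  exact Summit.QuantumFields.YangMills.Theorems.LocalInsertion.MedianOfInsertion.median_of_insertion F hγ hε a
    (measurableSet_window F γ b₀ p₀ K j a) (HF F γ hFL hγ hγa' K j hj hjK a) (HG F γ hFL hγ hγb' K j hj hjK a) (le_max_left _ _)
    (level_le_θBal_of_coupling_small F.hL.2.le hγ hγ1 hb₀ (by linarith) hγe (K - j))

end Summit.QuantumFields.YangMills.Theorems.LocalInsertion.IffWindowTailBelowCap
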